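import Literature.MeasureTheory.Group.ConjugationFamilyFibres     -- ★ `mem_normalizer_of_conj_eq` (conjugating one `T`-regular element of `T` to another normalises `T`)
import HarnessLib

/-!
# F0 · P3c · line LH6 «StCharTS» — «ELL-TOR★» FIBRE KIT: `W`-FREE NEIGHBOURHOODS IN A CARTAN SUBGROUP WITH FINITE WEYL GROUP, AND THE ONE-POINT FIBRES OF THE
# CONJUGATION FAMILY OVER THEM (generic group theory ∕ topology; Harish-Chandra 1970 Lemma 42, the injectivity half of Lemma 22's change of variables)

Cell `pub/hodgecm-mathlib`, crux H413 = `stmt-HodgeConjecture-24833` (lane `--supports`, helper); seat F0P3a-p05 (g22), road «ELL-TOR★» (NAMING 2026-09-02T14:19:42Z,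
JAC-LOC owner LH6-p03 (g5) «=» 14:22:45Z), brick (E1a) = the generic half of «JAC-CARTAN BY SHAPE».  THEOREMS ONLY; sorry-free; no definition ∕ instance ∕ notation ∕
named fact; Mathlib + ★ `Literature.MeasureTheory.Group.ConjugationFamilyFibres` only; axioms TRIO.

SETTING (the engine's: ★ `ConjugationFamilyFibres` ∕ `ConjugationWeylVanishing`).  `G` a group (topological, Hausdorff where said), `T ≤ G` an ABELIAN subgroup, `R ⊆ G`
(«regular elements») with `Z(t) = T` for every `t ∈ T ∩ R` (`hRT`), and `[N_G(T) : T] ≠ 0` (finite Weyl group, `hW`).  For the split torus `M` of `U(Φ₃)` the (TOR) road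
(★ p849811 ∕ ★ p851645) phrases «`V ⊆ M` is `W`-free» with THE Weyl element `w` (`t′ ≠ w t w⁻¹` on `V`) and proves one-point fibres by ★ (B1) `fibre_dichotomy`; for a
GENERAL Cartan `T = Z(γ₀)` (compact ones included) the Weyl group `N(T)∕T` is only known to be finite (★ WEYL-FIN), so this file re-does both steps over ALL of `G ∖ T`:

* **`W`-FREE** (a predicate written inline, no definition): `∀ n : G, n ∉ T → ∀ t ∈ V, ∀ t′ ∈ V, (t′ : G) ≠ n t n⁻¹` — no two points of `V` are conjugate by an element
  outside `T`.
* §1 `conj_eq_of_mem` ∕ **`mk_eq_and_eq_of_conj_eq_conj`** — ONE-POINT FIBRES: if `x t x⁻¹ = x′ t′ x′⁻¹` with `t, t′` in a `W`-free `V ⊆ T`, then `xT = x′T` and `t = t′`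
  (`n := x′⁻¹ x` conjugates `t` to `t′`; `n ∈ T` forces `t = t′` since `T` is abelian, `n ∉ T` is excluded by `W`-freeness) — ★ (B1) `fibre_dichotomy`'s role, with no
  Weyl element and no regularity needed.
* §2 **`exists_isOpen_wFree_nhds`** — every `t₀ ∈ T ∩ R` has an OPEN neighbourhood `U ⊆ T` such that `U ∩ R` is `W`-free (`G` Hausdorff topological group, `T` with the
  subspace topology): a conjugation `t′ = n t n⁻¹` between `T`-regular points of `T` forces `n ∈ N_G(T)` (★ `mem_normalizer_of_conj_eq`); the finitely many cosets
  `c ∈ N_G(T)∕T`, `c ≠ T`, act on `T` by homeomorphisms `t ↦ n_c t n_c⁻¹` moving `t₀` (`n_c ∉ T = Z(t₀)`), so Hausdorff separation of `t₀` from each `n_c t₀ n_c⁻¹` and a finite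
  intersection give `U`.  This is the «`w t₀ w⁻¹ ≠ t₀`» step §e of ★ p849811, uniform over all Cartans.
Consumed by the sequel `F0P3cStCharTSWeylCartanJacobian` («JAC-CARTAN BY SHAPE») at `G = U(Φ₃)(L⁺_v)`, `T = Z(γ₀)`, `R = {regular}`.

HONEST LABEL: count-neutral generic kit for the WIF antecedent of RUNG0's named block; closes no organ.  HC_CM is proved only modulo the 7 printed citations (2 remaining:
hLiu418 = `stmt-HodgeConjecture-24832`, h413 = `stmt-HodgeConjecture-24833`) until rung 0 closes.

## References
* [HarishChandra1970] Harish-Chandra, *Harmonic analysis on reductive p-adic groups*, LNM 162 (1970), Lemma 22 (the conjugation map `G⧸T × T′ → G` and its fibres), Lemma 42.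
* [Rogawski1990] J. D. Rogawski, *Automorphic Representations of Unitary Groups in Three Variables*, Ann. of Math. Stud. 123 (1990), §12.5 p. 182 (`|Ω(T, G)|⁻¹` in the
  Weyl integration formula), §3.5–§3.6 p. 28.
* [Bourbaki] N. Bourbaki, *Topologie Générale* III §2 (subgroups and quotients of topological groups) — background only.
-/

set_option autoImplicit false
-- the mandated namespace has the single-problem summit's repeated segment (`HodgeConjecture.HodgeConjecture`)
set_option linter.dupNamespace false

open Set Filter Topology Function
open Literature.MeasureTheory.Group

namespace Summit.HodgeConjecture.HodgeConjecture.Cruxes.H413.F0P3cStCharTSWeylCartanFibre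

section Fibre

variable {G : Type*} [Group G] (T : Subgroup G) (hTc : ∀ a ∈ T, ∀ b ∈ T, a * b = b * a)

/-! ## §1 One-point fibres of the conjugation family over a `W`-free set -/

/-- Group algebra: `x t x⁻¹ = x′ t′ x′⁻¹ ↔ (x′⁻¹ x) t (x′⁻¹ x)⁻¹ = t′`. [cite: HarishChandra1970, Lemma 22] -/
theorem conj_eq_conj_iff (x x' t t' : G) : x * t * x⁻¹ = x' * t' * x'⁻¹ ↔ (x'⁻¹ * x) * t * (x'⁻¹ * x)⁻¹ = t' := by
  constructor
  · intro h
    calc x'⁻¹ * x * t * (x'⁻¹ * x)⁻¹ = x'⁻¹ * (x * t * x⁻¹) * x' := by group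
      _ = x'⁻¹ * (x' * t' * x'⁻¹) * x' := by rw [h]
      _ = t' := by group
  · intro h
    calc x * t * x⁻¹ = x' * (x'⁻¹ * x * t * (x'⁻¹ * x)⁻¹) * x'⁻¹ := by group
      _ = x' * t' * x'⁻¹ := by rw [h]

include hTc in
/-- In an ABELIAN `T`, conjugation by an element of `T` fixes `T` pointwise: `n ∈ T`, `n t n⁻¹ = t′` (`t ∈ T`) ⇒ `t = t′`. [cite: HarishChandra1970, Lemma 22] -/
theorem eq_of_conj_eq_of_mem {n t t' : G} (hn : n ∈ T) (ht : t ∈ T) (h : n * t * n⁻¹ = t') : t = t' := by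
  rw [← h, hTc n hn t ht, mul_inv_cancel_right]

include hTc in
/-- **ONE-POINT FIBRES OVER A `W`-FREE SET.**  If `V ⊆ T` is `W`-free (`∀ n ∉ T`, no two points of `V` are `n`-conjugate) and `x t x⁻¹ = x′ t′ x′⁻¹` with `t, t′ ∈ V`, then
`xT = x′T` in `G ⧸ T` and `t = t′` — the fibre of the conjugation family `Φ(xT, t) = x t x⁻¹` through a point of `(G⧸T) × V` is that point.  (`n := x′⁻¹ x` conjugates `t` to
`t′`; `n ∉ T` is excluded by `W`-freeness, and `n ∈ T` gives both conclusions, `T` being abelian.) [cite: HarishChandra1970, Lemma 22; Lemma 42] -/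
theorem mk_eq_and_eq_of_conj_eq_conj {V : Set ↥T} (hV : ∀ n : G, n ∉ T → ∀ t ∈ V, ∀ t' ∈ V, ((t' : ↥T) : G) ≠ n * t * n⁻¹)
    {x x' : G} {t t' : ↥T} (ht : t ∈ V) (ht' : t' ∈ V) (h : x * (t : G) * x⁻¹ = x' * (t' : G) * x'⁻¹) :
    (QuotientGroup.mk x : G ⧸ T) = QuotientGroup.mk x' ∧ t = t' := by
  have hconj := (conj_eq_conj_iff x x' (t : G) (t' : G)).1 h
  by_cases hn : x'⁻¹ * x ∈ T
  · refine ⟨?_, Subtype.ext (eq_of_conj_eq_of_mem T hTc hn t.2 hconj)⟩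
    rw [eq_comm, QuotientGroup.eq]
    exact hn
  · exact absurd hconj.symm (hV _ hn t ht t' ht')

include hTc in
/-- The same, read on the preimage: over a `W`-free `V`, the fibre of `Φ` (any map with `Φ(xT, t) = x t x⁻¹`) through `y` meets `A₀ ×ˢ V` in at most one point (a subsingleton),
for EVERY `A₀ ⊆ G ⧸ T`. [cite: HarishChandra1970, Lemma 22; Lemma 42] -/
theorem subsingleton_preimage_inter_prod (Φ : (G ⧸ T) × ↥T → G) (hΦ : ∀ (x : G) (t : ↥T), Φ (QuotientGroup.mk x, t) = x * t * x⁻¹)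
    {V : Set ↥T} (hV : ∀ n : G, n ∉ T → ∀ t ∈ V, ∀ t' ∈ V, ((t' : ↥T) : G) ≠ n * t * n⁻¹) (A₀ : Set (G ⧸ T)) (y : G) :
    (Φ ⁻¹' {y} ∩ A₀ ×ˢ V).Subsingleton := by
  rintro ⟨q, t⟩ ⟨hyq, ⟨-, htV⟩⟩ ⟨q', t'⟩ ⟨hyq', ⟨-, ht'V⟩⟩
  obtain ⟨x, rfl⟩ := QuotientGroup.mk_surjective q
  obtain ⟨x', rfl⟩ := QuotientGroup.mk_surjective q'
  simp only [mem_preimage, mem_singleton_iff, hΦ] at hyq hyq'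
  obtain ⟨h1, h2⟩ := mk_eq_and_eq_of_conj_eq_conj T hTc hV htV ht'V (hyq.trans hyq'.symm)
  exact Prod.ext h1 h2

/-- `W`-freeness is inherited by subsets. [cite: HarishChandra1970, Lemma 42] -/
theorem wFree_mono {U V : Set ↥T} (hUV : V ⊆ U) (hU : ∀ n : G, n ∉ T → ∀ t ∈ U, ∀ t' ∈ U, ((t' : ↥T) : G) ≠ n * t * n⁻¹) :
    ∀ n : G, n ∉ T → ∀ t ∈ V, ∀ t' ∈ V, ((t' : ↥T) : G) ≠ n * t * n⁻¹ :=
  fun n hn t ht t' ht' => hU n hn t (hUV ht) t' (hUV ht')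

/-! ## §2 `W`-free neighbourhoods of `T`-regular points (finite Weyl group, Hausdorff group) -/

variable (R : Set G) (hRT : ∀ t : ↥T, (t : G) ∈ R → Subgroup.centralizer {(t : G)} = T)
  (hW : (T.subgroupOf (Subgroup.normalizer (T : Set G))).index ≠ 0)

include hRT in
/-- A conjugation between two `T`-REGULAR points of `T` normalises `T` (★ `mem_normalizer_of_conj_eq`); hence a conjugation by `n ∉ T` between them is by a NON-TRIVIAL
coset of `N_G(T) ∕ T`. [cite: HarishChandra1970, Lemma 42] -/
theorem mem_normalizer_of_conj_eq_of_mem {n : G} {t t' : ↥T} (ht : (t : G) ∈ R) (ht' : (t' : G) ∈ R) (h : n * (t : G) * n⁻¹ = t') :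
    n ∈ Subgroup.normalizer (T : Set G) :=
  mem_normalizer_of_conj_eq T (hRT t ht) (hRT t' ht') h

include hTc in
/-- Conjugation by `n s` and by `n` agree on `T` when `s ∈ T` (`T` abelian): the action of `N_G(T)` on `T` factors through `N_G(T) ∕ T`. [cite: HarishChandra1970, Lemma 42] -/
theorem conj_mul_of_mem (n : G) {s : G} (hs : s ∈ T) (t : ↥T) : n * s * (t : G) * (n * s)⁻¹ = n * (t : G) * n⁻¹ := by
  have hst : s * (t : G) = (t : G) * s := hTc s hs t t.2
  calc n * s * (t : G) * (n * s)⁻¹ = n * (s * (t : G)) * (s⁻¹ * n⁻¹) := by rw [mul_inv_rev]; group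
    _ = n * (t : G) * n⁻¹ := by rw [hst]; group

include hRT in
/-- A regular `t₀ ∈ T` is MOVED by conjugation by any `n ∉ T` that conjugates it into `T`: `n t₀ n⁻¹ ≠ t₀` — indeed `n t₀ n⁻¹ = t₀` puts `n ∈ Z(t₀) = T`.
[cite: HarishChandra1970, Lemma 42] -/
theorem conj_ne_self_of_not_mem {n : G} (hn : n ∉ T) {t₀ : ↥T} (ht₀ : (t₀ : G) ∈ R) : n * (t₀ : G) * n⁻¹ ≠ t₀ := by
  intro h
  apply hn
  rw [← hRT t₀ ht₀, Subgroup.mem_centralizer_singleton_iff]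
  exact (mul_inv_eq_iff_eq_mul.1 h)

include hTc hRT hW in
/-- **`W`-FREE NEIGHBOURHOODS EXIST**: in a Hausdorff topological group, every `T`-regular `t₀ ∈ T` (`t₀ ∈ R`) has an open neighbourhood `U` in `T` whose regular part
`U ∩ R` is `W`-free — no two of its points are conjugate by an element outside `T`.  Proof: such a conjugation is by some `n ∈ N_G(T) ∖ T`
(`mem_normalizer_of_conj_eq_of_mem`), whose action on `T` is that of its coset (`conj_mul_of_mem`); the cosets are finitely many (`hW`) and each non-trivial one moves
`t₀` (`conj_ne_self_of_not_mem`), so Hausdorff separation of `t₀` from `n_c t₀ n_c⁻¹` for each coset representative `n_c ∉ T` and a finite intersection do it.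
[cite: HarishChandra1970, Lemma 42] [cite: Rogawski1990, §3.5 p. 28] -/
theorem exists_isOpen_wFree_nhds [TopologicalSpace G] [IsTopologicalGroup G] [T2Space G] (t₀ : ↥T) (ht₀ : (t₀ : G) ∈ R) :
    ∃ U : Set ↥T, IsOpen U ∧ t₀ ∈ U ∧
      ∀ n : G, n ∉ T → ∀ t ∈ U ∩ {t : ↥T | (t : G) ∈ R}, ∀ t' ∈ U ∩ {t : ↥T | (t : G) ∈ R}, ((t' : ↥T) : G) ≠ n * t * n⁻¹ := by
  classical
  set N : Subgroup G := Subgroup.normalizer (T : Set G) with hN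
  haveI : (T.subgroupOf N).FiniteIndex := ⟨hW⟩
  haveI : Finite (N ⧸ T.subgroupOf N) := Subgroup.finite_quotient_of_finiteIndex
  -- for each coset `c`, separate `t₀` from `n_c t₀ n_c⁻¹` when the representative `n_c = c.out` lies outside `T`
  have hsep : ∀ c : N ⧸ T.subgroupOf N, ∃ O₁ O₂ : Set G, IsOpen O₁ ∧ IsOpen O₂ ∧ (t₀ : G) ∈ O₁ ∧
      (c.out : G) * (t₀ : G) * (c.out : G)⁻¹ ∈ O₂ ∧ ((c.out : G) ∉ T → Disjoint O₁ O₂) := by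
    intro c
    by_cases hc : (c.out : G) ∈ T
    · exact ⟨univ, univ, isOpen_univ, isOpen_univ, mem_univ _, mem_univ _, fun h => absurd hc h⟩
    · obtain ⟨O₁, O₂, hO₁, hO₂, h₁, h₂, hdisj⟩ := t2_separation (conj_ne_self_of_not_mem T R hRT hc ht₀).symm
      exact ⟨O₁, O₂, hO₁, hO₂, h₁, h₂, fun _ => hdisj⟩
  choose O₁ O₂ hO₁ hO₂ h₁ h₂ hdisj using hsep
  have hcont : ∀ c : N ⧸ T.subgroupOf N, Continuous fun t : ↥T => (c.out : G) * (t : G) * (c.out : G)⁻¹ := fun c =>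
    (continuous_const.mul continuous_subtype_val).mul continuous_const
  refine ⟨⋂ c : N ⧸ T.subgroupOf N, {t : ↥T | (t : G) ∈ O₁ c ∧ (c.out : G) * (t : G) * (c.out : G)⁻¹ ∈ O₂ c}, ?_, ?_, ?_⟩
  · exact isOpen_iInter_of_finite fun c => ((hO₁ c).preimage continuous_subtype_val).inter ((hO₂ c).preimage (hcont c))
  · exact mem_iInter.2 fun c => ⟨h₁ c, h₂ c⟩
  · rintro n hn t ⟨htU, htR⟩ t' ⟨ht'U, ht'R⟩ h
    -- `n` normalises `T`; its coset representative `n_c = n s` (`s ∈ T`) lies outside `T` and conjugates `t` to `t′` as `n` does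
    have hnN : n ∈ N := mem_normalizer_of_conj_eq_of_mem T R hRT htR ht'R h.symm
    set c : N ⧸ T.subgroupOf N := QuotientGroup.mk ⟨n, hnN⟩ with hcdef
    obtain ⟨s, hs⟩ := QuotientGroup.mk_out_eq_mul (T.subgroupOf N) (⟨n, hnN⟩ : N)
    have hsT : ((s : N) : G) ∈ T := Subgroup.mem_subgroupOf.1 s.2
    have hout : (c.out : G) = n * ((s : N) : G) := by
      rw [hcdef, hs]; rfl
    have hcT : (c.out : G) ∉ T := by
      intro h'
      apply hn
      have : n = (c.out : G) * (((s : N) : G))⁻¹ := by rw [hout, mul_inv_cancel_right]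
      rw [this]
      exact T.mul_mem h' (T.inv_mem hsT)
    have hconj : (c.out : G) * (t : G) * (c.out : G)⁻¹ = t' := by
      rw [hout, conj_mul_of_mem T hTc n hsT t]
      exact h.symm
    have ht2 : ((t' : ↥T) : G) ∈ O₂ c := by rw [← hconj]; exact ((mem_iInter.1 htU) c).2
    have ht1 : ((t' : ↥T) : G) ∈ O₁ c := ((mem_iInter.1 ht'U) c).1
    exact (hdisj c hcT).ne_of_mem ht1 ht2 rfl

end Fibre

end Summit.HodgeConjecture.HodgeConjecture.Cruxes.H413.F0P3cStCharTSWeylCartanFibre
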